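import Summits.Ventures.CertifiedManyBodySolver.Rows.CorrWindowCertKernelChain
import HarnessLib

/-!
# PACKED accumulators for the encoded merge chain: an `EncPoly` as a short list of big naturals — the COMPILED CARRIER between
# chain steps (`packMany` / `unpackMany`, used by `eval%`), so that `eval%` chaining works at ANY accumulator size

HONEST FRAMING: Lean plumbing towards «tier P». MEASURED (seat g23, HOME/STATUS «MEASUREMENT» 22:15:24Z, «ANSWER» 22:21:56Z and the
pack probes reported with this file): (1) an accumulator of the encoded merge chain (`Rows/CorrWindowCertKernelChain.lean`) written
as a PLAIN list literal cannot be a compiled `def` above ≈ 1.6·10⁴ entries, so `C_{i+1} := eval% stepE B C_i slice_i` (which needs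
`C_i` compiled) stops there; (2) a TEXTUAL 1.4·10⁴-entry list literal does not elaborate within 30 min; (3) the farm refuses sources
above 512 KB; (4) a plain literal materialised by `eval%` into a `noncomputable def` IS read by the kernel up to ≈ 3.6·10⁴ entries per
step (PASS), whereas a kernel that must itself UNPACK packed naturals inside the step declaration FAILS already at 1.5·10⁴ terms.
Hence the DESIGN OF RECORD for real chains, which this file enables (probe «PACKv2», 29 400 → 38 133 terms, PASS 129 s):

  `def L₁ : List Chunk := eval% packMany p 128 (stepE B (unpackMany p L₀) (slices.getD 0 []))`   — COMPILED carrier: ≈ terms/128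
                                                                                                     chunks of four naturals (compiles
                                                                                                     and elaborates instantly);
  `noncomputable def C₁ : EncPoly := eval% unpackMany p L₁`                                        — the PLAIN kernel literal,
                                                                                                     materialised at elaboration;
  `theorem step₀ : Cs.getD 1 [] = stepE B (Cs.getD 0 []) (slices.getD 0 []) := eq_of_beq (by decide +kernel)` with `Cs := [[], C₁, …]`
  — the kernel never packs or unpacks; the SOURCE holds no accumulator literal at all (the exporter emits slices, hints and group sizes
  only; `eval%` computes every accumulator in Lean); the same for the hinted step `stepEQ` of `Rows/CorrWindowCertKernelChainQuot.lean`.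

THE LAYOUT (also a byte contract if an exporter ever wants to emit or read carriers; all digit streams LITTLE-ENDIAN, first term =
lowest digits): `PackParams = (Bn, off, Bd)` — numerator base and offset (numerator `x` stored as the digit `x + off < Bn`),
denominator base (`den < Bd`); words stream `nw`, base 256: per term ONE digit `lenC + 16·lenA` (`lenC, lenA < 16`), then the `lenC`
creator codes, then the `lenA` annihilator codes (each `< 256`; the chain's letter codes are `2·site + spin`); numerators stream `nn`,
base `Bn`, one digit per term; denominators stream `nd`, base `Bd`, one digit per term; a chunk `(cnt, nw, nn, nd)` decodes to `cnt`
terms and `unpackMany` concatenates chunks. `packMany p size E` cuts `E` into consecutive chunks of `size` terms and packs each;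
`paramsFor E` = the smallest admissible parameters (ALL accumulators of one chain should share one generous `p`, e.g.
`⟨2^160, 2^159, 2^96⟩` for `K = 40` data); `unpackMany_packMany_demo` checks the round trip on a sample by `decide`. Nothing here is
trusted: chain facts are equations between PLAIN polynomials; a lossy carrier could only make a fact undecidable. No theorem about
certificates; nothing of record moves; CONTROL/CALIBRATION context (wording (xx1)); no summit statement is proved by this file. Seat
hubbard-obs-p2 (STIFFNESS), `prover-hubbard-obs-p2-g23-0`, zero compute.

References: C. Jansson, D. Chaykin, C. Keil, SIAM J. Numer. Anal. 46 (2008) 180 [JanssonChaykinKeil2008] (certificate data as exact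
rationals); the packing device follows `CertifiedQuantumChemistry/Rows/V2RDMDualKernelPack.lean` [folklore].
-/

namespace Summit.Ventures.CertifiedManyBodySolver

namespace CARPolyWindow

open Summit.Ventures.CertifiedQuantumChemistry

namespace PackE

/-- Packing parameters: numerator base, numerator offset, denominator base. [folklore] -/
structure PackParams where
  /-- numerator base (`num + off < Bn` for every term) -/
  Bn : ℕ
  /-- numerator offset (`0 ≤ num + off`) -/
  off : ℕ
  /-- denominator base (`den < Bd`) -/
  Bd : ℕ

/-- A packed chunk: `(term count, words numeral, numerators numeral, denominators numeral)`. [folklore] -/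
abbrev Chunk := ℕ × ℕ × ℕ × ℕ

/-! ## Decoding (run by `eval%`; kernel-evaluable for small inputs) -/

/-- `cnt` little-endian base-`B` digits of `n`. [folklore] -/
def digits (B : ℕ) : ℕ → ℕ → List ℕ
  | 0, _ => []
  | c + 1, n => (n % B) :: digits B c (n / B)

/-- `cnt` encoded monomials from the base-256 words stream (length digit `lenC + 16·lenA`, then the codes). [folklore] -/
def words : ℕ → ℕ → List (List ℕ × List ℕ)
  | 0, _ => []
  | c + 1, n =>
    let L := n % 256
    let lc := L % 16
    let la := L / 16
    let n₁ := n / 256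
    let n₂ := n₁ / 256 ^ lc
    (digits 256 lc n₁, digits 256 la n₂) :: words c (n₂ / 256 ^ la)

/-- One chunk decoded: words, numerators `digit − off`, denominators. [folklore] -/
def unpackChunk (p : PackParams) (c : Chunk) : SOSDual.EncPoly :=
  List.zipWith (fun w nd => (w, ((nd.1 : ℤ) - p.off, nd.2))) (words c.1 c.2.1)
    (List.zip (digits p.Bn c.1 c.2.2.1) (digits p.Bd c.1 c.2.2.2))

/-- **The accumulator a chunk list denotes** (evaluated by `eval%` when materialising the kernel literal `C_i`; NOT meant to be
unfolded by the kernel at scale — measured FAIL at 1.5·10⁴ terms). [folklore] -/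
def unpackMany (p : PackParams) (chunks : List Chunk) : SOSDual.EncPoly := chunks.flatMap (unpackChunk p)

/-! ## Encoding (`eval%` side only; never evaluated by the kernel) -/

/-- Append base-`B` digits (little-endian) in front of a tail numeral. [folklore] -/
def undigits (B : ℕ) : List ℕ → ℕ → ℕ
  | [], tail => tail
  | d :: ds, tail => d + B * undigits B ds tail

/-- The words numeral of a term list (inverse of `words`). [folklore] -/
def packWords : List (List ℕ × List ℕ) → ℕ
  | [] => 0
  | (cs, as) :: ws => (cs.length + 16 * as.length) + 256 * undigits 256 cs (undigits 256 as (packWords ws))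

/-- One chunk packed. [folklore] -/
def packChunk (p : PackParams) (E : SOSDual.EncPoly) : Chunk :=
  (E.length,
   packWords (E.map Prod.fst),
   undigits p.Bn (E.map fun t => (t.2.1 + (p.off : ℤ)).toNat) 0,
   undigits p.Bd (E.map fun t => t.2.2) 0)

/-- Cut a list into consecutive pieces of length `size` (fuel = the list length; `size = 0` is read as `1`). [folklore] -/
def chunksOf {α : Type*} (size : ℕ) : ℕ → List α → List (List α)
  | 0, _ => []
  | _ + 1, [] => []
  | fuel + 1, L => L.take (max size 1) :: chunksOf size fuel (L.drop (max size 1))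

/-- **The packed form of an accumulator** (chunks of `size` terms). [folklore] -/
def packMany (p : PackParams) (size : ℕ) (E : SOSDual.EncPoly) : List Chunk :=
  (chunksOf size E.length E).map (packChunk p)

/-- The smallest parameters that hold a given accumulator (the exporter / `eval%` may use any larger ones; ALL accumulators compared in
one step fact must be read with the SAME parameters). [folklore] -/
def paramsFor (E : SOSDual.EncPoly) : PackParams :=
  let off := (E.map fun t => t.2.1.natAbs).foldl max 0
  let bd := (E.map fun t => t.2.2).foldl max 0
  ⟨2 * off + 1, off, bd + 1⟩

/-! ## Round trip on a sample (documentation of the layout; decided by the kernel) -/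

/-- A sample encoded polynomial: unit monomial, one- and two-letter words, negative and large numerators. [folklore] -/
def demoE : SOSDual.EncPoly :=
  [(([], []), (3, 4)), (([0], [0]), (-1, 1)), (([2, 17], [17, 2]), (123456789012345678901234567890, 1099511627776)),
   (([5], [7]), (-98765432109876543210, 5)), (([1, 3, 4], [4]), (0, 1)), (([], [9, 8]), (7, 40))]

/-- **Round trip**: unpacking the packed sample (chunks of 4 terms, parameters `paramsFor demoE`) returns the sample. [folklore] -/
theorem unpackMany_packMany_demo : unpackMany (paramsFor demoE) (packMany (paramsFor demoE) 4 demoE) = demoE := by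
  decide +kernel

/-! ## Wide letters: the same layout with a letter base `Bw` (outer windows with more than 128 sites have codes `2·site + spin ≥ 256`;
e.g. `Bw = 4096` for the 25 × 25 window of the La214 Rm2 geometry, codes ≤ 1 249) — appended by seat g23 after the geometry decision
(HOME/STATUS «ANSWER (R0)–(R4)» 23:11:25Z); the base-256 functions above are the case `Bw = 256` up to the length digit, unchanged. -/

/-- `cnt` encoded monomials from a base-`Bw` words stream (length digit `lenC + 16·lenA` in base 256, codes in base `Bw`). [folklore] -/
def wordsB (Bw : ℕ) : ℕ → ℕ → List (List ℕ × List ℕ)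
  | 0, _ => []
  | c + 1, n =>
    let L := n % 256
    let lc := L % 16
    let la := L / 16
    let n₁ := n / 256
    let n₂ := n₁ / Bw ^ lc
    (digits Bw lc n₁, digits Bw la n₂) :: wordsB Bw c (n₂ / Bw ^ la)

/-- One chunk decoded with letter base `Bw`. [folklore] -/
def unpackChunkB (Bw : ℕ) (p : PackParams) (c : Chunk) : SOSDual.EncPoly :=
  List.zipWith (fun w nd => (w, ((nd.1 : ℤ) - p.off, nd.2))) (wordsB Bw c.1 c.2.1)
    (List.zip (digits p.Bn c.1 c.2.2.1) (digits p.Bd c.1 c.2.2.2))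

/-- **The accumulator a chunk list denotes, letter base `Bw`** (`eval%` side; the kernel literal is materialised from it). [folklore] -/
def unpackManyB (Bw : ℕ) (p : PackParams) (chunks : List Chunk) : SOSDual.EncPoly := chunks.flatMap (unpackChunkB Bw p)

/-- The words numeral of a term list with letter base `Bw` (inverse of `wordsB`). [folklore] -/
def packWordsB (Bw : ℕ) : List (List ℕ × List ℕ) → ℕ
  | [] => 0
  | (cs, as) :: ws => (cs.length + 16 * as.length) + 256 * undigits Bw cs (undigits Bw as (packWordsB Bw ws))

/-- One chunk packed with letter base `Bw`. [folklore] -/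
def packChunkB (Bw : ℕ) (p : PackParams) (E : SOSDual.EncPoly) : Chunk :=
  (E.length,
   packWordsB Bw (E.map Prod.fst),
   undigits p.Bn (E.map fun t => (t.2.1 + (p.off : ℤ)).toNat) 0,
   undigits p.Bd (E.map fun t => t.2.2) 0)

/-- **The packed carrier of an accumulator, letter base `Bw`** (chunks of `size` terms). [folklore] -/
def packManyB (Bw : ℕ) (p : PackParams) (size : ℕ) (E : SOSDual.EncPoly) : List Chunk :=
  (chunksOf size E.length E).map (packChunkB Bw p)

/-- A sample with letter codes beyond 256 (sites of a 25 × 25 window). [folklore] -/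
def demoEwide : SOSDual.EncPoly :=
  [(([], []), (3, 4)), (([1249], [0]), (-1, 1)), (([300, 1248], [1248, 300]), (123456789012345678901234567890, 1099511627776)),
   (([5], [700]), (-98765432109876543210, 5)), (([1, 3, 1000], [4]), (0, 1))]

/-- **Round trip, wide letters**: base `4096`, chunks of 2 terms. [folklore] -/
theorem unpackManyB_packManyB_demo :
    unpackManyB 4096 (paramsFor demoEwide) (packManyB 4096 (paramsFor demoEwide) 2 demoEwide) = demoEwide := by
  decide +kernel

end PackE

end CARPolyWindow

end Summit.Ventures.CertifiedManyBodySolver
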